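import Summits.QuantumFields.BalabanUV.T4Continuum.Spine.NE1p.DressedSmallFieldFamilyAmplitude
import Summits.QuantumFields.BalabanUV.T4Continuum.Spine.NE1p.DressedSmallFieldCoveringFamiliesFaces

/-!
# T⁴ programme, spine estimate NE1′ (node O3b/H2) — THE (2.28)-AMPLITUDE ENDs OF N0t WITHOUT A RADIUS BINDER AND WITHOUT A GEOMETRY
# HYPOTHESIS AT EITHER SCALE: `muPart_locE_le_of_coresAt_pencil_families` and `attachedPart_locE_le_of_coresAt_pencil_radii` ϱ-free over a
# `B13Resummation.Geometry` (N0m §4b's SHARP room 3) and on pv22's tori `tgeometry 4 N` ∕ `tgeometry 4 M` with located numerals, + the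
# (2.28) ∘ torus square in kernel

Cell `pub-balaban`, sub-cell `t4`, BINDER-OWNERS row NE1′ (owner lineage t4-ne1p-p1); crew seat `b2b-balaban-t4-ne1p-formalise-leaf-05`
(LEAF PROVER 05, generation 11); crew FACE row (INTENT `CLAIMS.log` 2026-08-20 l.19083; R-T102 (i)'s invariant «every owner END with a
`Geometry` socket gets its faces» — the third file of the N0s∕N0t faces after row S34's PART 1 `DressedSmallFieldFamilyCountFaces` (p231123) ∕
PART 2 `DressedSmallFieldCoveringFamiliesFaces` (p231585)).  ADDITIVE — imports the owner's N0t `Spine/NE1p/DressedSmallFieldFamilyAmplitude` (⇒ N0s ⇒ N0r ⇒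
N0q ⇒ N0p ⇒ N0o ⇒ N0m v1.2) and S34 PART 2 `Spine/NE1p/DressedSmallFieldCoveringFamiliesFaces` (⇒ PART 1, S24; for the located families END
and `count_coveringFamilies_torus`) ONLY; THEOREMS ONLY (+ one `example`; 0 `def`, 0 `def … : Prop`); nothing of N0t ∕ N0s ∕ N0r ∕ N0q ∕ N0p ∕
N0o ∕ N0m ∕ S24–S34 ∕ b13 ∕ pv22 restated — their declarations are used BY NAME.

WHY THIS FILE.  N0t supplies (B3-amp) of N0s's families END from letters of (2.15)∕(2.18)-FORM by print's (2.28) arithmetic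
(`prod_radiusLetters_le`) and adds the source-pencil twin of the families END; both ENDs keep (i) the step geometry
`G : B13Resummation.Geometry D Cube` with the clauses at `G`'s letters (`hrate`, `hsmall`), (ii) N0m §2's radius conditions `hϱ : 2 ≤ ϱ`,
`hϱA : A₀ ≤ ϱ·A₁` (attached part), and (iii) the scale-`k` socket `Gk : Geometry Dk CubeK` with (2.29)'s order-of-choice clauses
`hκ : Gk.κ₀ + 1 ≤ δκ`, `h229 : e·Gk.K₀·Gk.c₁·α₆ ≤ 1`.  THIS FILE gives them their faces — the S25–S34 pattern verbatim:
* §1 over ONE `G` (and an abstract `Gk`): `attachedPart_locE_le_of_coresAt_pencil_radii_printClause_three` — N0t's radii END at the pencil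
  radius `ϱ⋆ := max 2 (A₀/A₁)` with `hϱ` ∕ `hϱA` ∕ `hsmall` SUPPLIED BY NAME by N0m's `two_le_pencilRadius` ∕ `intercept_le_pencilRadius_mul` ∕
  `pencilClause_of_printClause_three` under a live slope `0 < A₁ ≤ A₀` and `h3 : 3·A₀·(e^{b₅+1}·G.K₀·G.ν·G.c₁) ≤ 1`; the class radius `hH`,
  `hform`'s growth letter `e^{N₁(‖h₀‖ + ϱ⋆‖w‖)}` and the amplitude bookkeeping `hamp : Gc Z·(θα₆⁻¹e^{5R}) ≤ A₀ + ϱ⋆A₁` are READ AT `ϱ⋆`.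
* §2 on pv22's tori (`D := tsys 4 N`, `G := tgeometry 4 N`; `Dk := tsys 4 M`, `Gk := tgeometry 4 M`; constants LOCATED AS NUMERALS by N0o
  `torus_consts` + S24 `K₀_four` at BOTH scales: ν = 9, κ₀ = 64·log 162, c₁ = 64, K₀ = `B12TreeDecay.K₀ 64 8`; (2.27)'s `c = 5` via
  `b₅ := 5·r₁`): `muPart_locE_le_of_coresAt_pencil_families_torus` (N0t's μ-families END ONCE, general source window `0 < μ₀ < μ₁`),
  `attachedPart_locE_le_of_coresAt_pencil_radii_torus` (N0t's radii END ONCE, general ϱ) and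
  `attachedPart_locE_le_of_coresAt_pencil_radii_printClause_three_torus` (§1 ONCE on the tori — NO geometry hypothesis, NO radius binder).
  Conclusions LITERALLY the crew currency `4·(e·9·64·K₀(64,8)²)·A₁·e^{−r₁·torusTreeLen X₀}` and N0o's μ-part currency.
* §3 one `example` — THE (2.28) ∘ TORUS SQUARE IN KERNEL: §2's radii torus face IS S34 PART 2's located families END
  `attachedPart_locE_le_of_coresAt_pencil_families_torus` with `hAmp` SUPPLIED from `hform` by N0t's `prod_radiusLetters_le` +
  `nonempty_of_mem_coveringFamilies` (N0t's own proof transplanted to the tori: radii-then-torus = torus-then-radii) — NO new inequality.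
WHAT STAYS DISPLAYED (binders, by name; NOTHING instantiated on Bałaban's densities): the room `hroom`; the operator conditions
`hm`∕`hN`∕`hq`; the class radii `hO`∕`hH`; (B1b)'s residue `terms`∕`emb`∕`hscale`∕`hact`, `hterms` (terms = covering families of `(foot Z).1`,
(B1b) READING) with `foot`∕`hmono` ((2.36) KIND, factor 1); (B3-form) `hform` — the letters have the (2.15)∕(2.18) FORM
`Gc Z·Π_{Y∈𝐃} θ·e^{−(1−3δ)κ·torusTreeLen Y}` with the «size half» `e^{N₁R₀}` inside (READING); (B3-arith) `hRδ : R + δκ ≤ (1−3δ)κ`,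
`hclause : θ·e^{5R} ≤ α₆` (p. 18 clause KIND at the dressed `θ`), `hamp`; `hθ`∕`hGc`∕`hα₆ : 0 < α₆`; `hA₀`∕`hA₁`∕`hA`, `hr₁`; for the μ-twin
(B3-amp) `hAmp` at the table radius `‖h₀‖ + μ₁‖v‖`; and the located clauses «κ large» `r₁ + 2·(64·log 162) + 2 ≤ R` ∕ `64·log 162 + 1 ≤ δκ`,
«ε₁ small» `(A₀ + ϱA₁)·E ≤ 1` ∕ `3·A₀·E ≤ 1` ∕ `A·E ≤ 1`, `E = e^{5r₁+1}·K₀(64,8)·9·64`, «α₆ small» `e·K₀(64,8)·64·α₆ ≤ 1` ((B5): SHAPES and the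
factor `3` consumed BY NAME; their standing against print's NUMBERS is NOT asserted).  (B4) is discharged BY NAME on pv22's CONSTRUCTED torus
geometries; the identification of `tsys 4 N` ∕ `tsys 4 M` ∕ `torusTreeLen` with Bałaban's 𝐃_{k+1} ∕ 𝐃_k ∕ d_{k+1} ∕ d_k (and of WHICH `M` is
the scale-`k` torus) is pv22's READING (DIVERGENCE D-pv22.3), not asserted; `foot`∕`hmono` are DISPLAYED binders — the L-refinement between
the two tori is NOT constructed here; no wall item moves; the wall line (v1.7 of record, T4-DAG v45) does NOT move; R-t4r2-Q2 NOT met thereby.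
HONEST FRAMING.  Kernel bookkeeping; the cores ∕ covering families ∕ radius letters are the cell's typed FORMAT of (2.14)∕(2.15)∕(2.18) and of
the 𝐃-resummation index, NOT Bałaban's functions; printed loci ([Balaban1988RGII] (2.14)–(2.15) p. 15, (2.18) p. 16, p. 17, (1.26) p. 8,
(2.26)–(2.29) p. 17–18, (2.36) p. 19, (2.38) p. 20; [Balaban1987RGI] p. 257) are TYPE ∕ CONTEXT through the imported cite-tagged Literature
modules, re-asserted nowhere; ABSOLUTE RULE honoured ([folklore] kernel lemmas only).  NE1′ ⇐ the named binders — NOT printed, NOT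
proved; 0 leaves instantiated on Bałaban's densities; spine PROVED 0∕9; count 9 unchanged.  Rung (B)+1 on ONE finite four-torus — NOT
infinite volume, NOT a mass gap, NOT OS on ℝ⁴, NOT Clay.  HONEST DEPENDENCY: continuum YM on T⁴ ⇐ BetaPertH ∧ nine spine estimates
(0/9 proved); BetaPertH ⇐ (D1) ∧ (D4) ∧ CAP+tail; G-an2-4 gates asym, D1 and NE2/3/4.
-/
noncomputable section

namespace Summit.QuantumFields.BalabanUV.T4Continuum.NE1p.DressedSmallFieldFamilyAmplitudeFaces

open Metric Set Complex MeasureTheory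
open scoped BigOperators
open Literature.MathematicalPhysics.QuantumFieldTheory.Balaban1983to89 (LocDomainSys)
open Literature.MathematicalPhysics.QuantumFieldTheory.Balaban1983to89.T4OutputRate (Carriers)
open Literature.MathematicalPhysics.QuantumFieldTheory.Balaban1983to89.B13Resummation (locE Geometry)
open Literature.MathematicalPhysics.QuantumFieldTheory.Balaban1983to89.B13FamilySum (coveringFamilies)
open Literature.MathematicalPhysics.QuantumFieldTheory.Balaban1983to89.TreeLengthTorus (tsys torusTreeLen torusTreeLen_nonneg)
open Literature.MathematicalPhysics.QuantumFieldTheory.Balaban1983to89.TreeLengthTorusGeometry (TTouch tgeometry)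
open Literature.MathematicalPhysics.QuantumFieldTheory.Balaban1983to89.B12TreeDecay (K₀)
open Summit.QuantumFields.BalabanUV.T4Continuum.B13HistMeasurable (MeasPotFrame B13HistM)
open Summit.QuantumFields.BalabanUV.T4Continuum.B13TermParamGaussianBi (BiCore)
open Summit.QuantumFields.BalabanUV.T4Continuum.NE1p.DressedSmallFieldFamilyAmplitude (prod_radiusLetters_le
  nonempty_of_mem_coveringFamilies muPart_locE_le_of_coresAt_pencil_families attachedPart_locE_le_of_coresAt_pencil_radii)
open Summit.QuantumFields.BalabanUV.T4Continuum.NE1p.DressedSmallFieldCoveringFamiliesFaces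
  (attachedPart_locE_le_of_coresAt_pencil_families_torus)
open Summit.QuantumFields.BalabanUV.T4Continuum.NE1p.DressedSmallFieldInduction (two_le_pencilRadius
  intercept_le_pencilRadius_mul pencilClause_of_printClause_three)
open Summit.QuantumFields.BalabanUV.T4Continuum.NE1p.DressedSmallFieldGeometry (torus_consts)
open Summit.QuantumFields.BalabanUV.T4Continuum.NE1p.DressedSmallFieldGeometryFaces (K₀_four)

/-! ## §1 THE ϱ-FREE FORM OF THE RADII END OVER A `B13Resummation.Geometry` — N0m §4∕§4b's arithmetic BY NAME (sharp room 3) -/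

section OfGeometry

variable {C : Carriers} {P : MeasPotFrame C} {Op : Type*} [NormedAddCommGroup Op] [NormedSpace ℂ Op] {Dk : LocDomainSys}
  {𝒴 : ℕ → Finset Dk.Dom → Type*} {dom : ∀ k i, 𝒴 k i → C.Dom} {β : ℕ → Finset Dk.Dom → Type*}
  [∀ k i, MeasurableSpace (β k i)] {α : ℕ → Finset Dk.Dom → Type*} [∀ k i, NormedAddCommGroup (α k i)]
  [∀ k i, InnerProductSpace ℝ (α k i)] [∀ k i, FiniteDimensional ℝ (α k i)] [∀ k i, MeasurableSpace (α k i)]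
  [∀ k i, BorelSpace (α k i)]
variable (D : LocDomainSys) {Cube : Type} [DecidableEq Cube] (G : Geometry D Cube) {CubeK : Type} [DecidableEq CubeK]
  (Gk : Geometry Dk CubeK)

open Classical in
/-- **THE RADII END UNDER PRINT'S CLAUSE WITH THE SHARP FACTOR-3 ROOM — NO RADIUS BINDER** (kernel; N0t
`attachedPart_locE_le_of_coresAt_pencil_radii` ONCE BY NAME at the pencil radius `ϱ⋆ := max 2 (A₀/A₁)`, its `hϱ` ∕ `hϱA` ∕ `hsmall` SUPPLIED
by N0m §4∕§4b's `two_le_pencilRadius` ∕ `intercept_le_pencilRadius_mul` ∕ `pencilClause_of_printClause_three` BY NAME): for a live attached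
slope `0 < A₁ ≤ A₀`, «κ large» `hrate`, «ε₁ small AT THE UNDRESSED CONSTANT with the sharp factor-3 room»
`h3 : 3·A₀·(e^{b₅+1}·G.K₀·G.ν·G.c₁) ≤ 1`, the scale-`k` socket `Gk` with (2.29)'s clauses, the (2.15)∕(2.18)-FORM `hform` and the amplitude
bookkeeping `hamp` READ AT `ϱ⋆` (as is `hH`), the (2.28) clauses `hRδ`∕`hclause` — other binders N0t's verbatim — the attached part of the
families activity is `≤ 4·(e·G.ν·G.c₁·G.K₀²)·A₁·e^{−r₁ d(X₀)}`. [folklore] -/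
theorem attachedPart_locE_le_of_coresAt_pencil_radii_printClause_three {W : Set (ℕ → ℝ)}
    {ctr : ℕ → (ℕ → ℝ) → C.BgB → Op × B13HistM P} {ROp RHist R' : ℕ → ℝ}
    (𝔊 : ∀ k i, C.Dom → BiCore P (dom k i) Op (β k i) (α k i)) {mq bq N₀ : ℕ → Finset Dk.Dom → C.Dom → ℝ}
    (hroom : ∀ k, ROp k < R' k)
    (hm : ∀ k, ∀ g ∈ W, ∀ (U : C.BgB) (X : C.Dom), C.scale X = k → ∀ i, 0 < mq k i X)
    (hN : ∀ k, ∀ g ∈ W, ∀ (U : C.BgB) (X : C.Dom), C.scale X = k → ∀ i,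
      (∀ o ∈ ball (ctr k g U).1 (R' k), AEStronglyMeasurable ((𝔊 k i X).N o) (𝔊 k i X).lam) ∧
      (∀ p, DifferentiableOn ℂ (fun o => (𝔊 k i X).N o p) (ball (ctr k g U).1 (R' k))) ∧
      (∀ o ∈ ball (ctr k g U).1 (R' k), ∀ p, ‖(𝔊 k i X).N o p‖ ≤ N₀ k i X))
    (hq : ∀ k, ∀ g ∈ W, ∀ (U : C.BgB) (X : C.Dom), C.scale X = k → ∀ i,
      (∀ o ∈ ball (ctr k g U).1 (R' k),
        AEStronglyMeasurable (Function.uncurry ((𝔊 k i X).q o)) ((𝔊 k i X).lam.prod volume)) ∧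
      (∀ p v, DifferentiableOn ℂ (fun o => (𝔊 k i X).q o p v) (ball (ctr k g U).1 (R' k))) ∧
      (∀ o ∈ ball (ctr k g U).1 (R' k), ∀ p v, mq k i X * ‖v‖ ^ 2 - bq k i X ≤ ((𝔊 k i X).q o p v).re))
    {k : ℕ} {g : ℕ → ℝ} (hg : g ∈ W) {U : C.BgB} {o : Op} {h₀ w : B13HistM P} {A₀ A₁ : ℝ}
    (hO : ‖o - (ctr k g U).1‖ ≤ ROp k) (hH : ‖h₀ - (ctr k g U).2‖ + max 2 (A₀ / A₁) * ‖w‖ ≤ RHist k)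
    {emb : D.Dom → C.Dom} (hscale : ∀ Z, C.scale (emb Z) = k) {terms : D.Dom → Finset (Finset Dk.Dom)}
    {act : ℂ → D.Dom → ℂ}
    (hact : ∀ s ∈ ball (0 : ℂ) (max 2 (A₀ / A₁)), ∀ Z, act s Z = ∑ i ∈ terms Z, (𝔊 k i (emb Z)).termAt o (h₀ + s • w))
    {R r₁ b₅ : ℝ} {X₀ : D.Dom} (hA₀ : 0 ≤ A₀) (hA₁ : 0 < A₁) (hle : A₁ ≤ A₀) (hr₁ : 0 ≤ r₁) (hb : r₁ * 5 ≤ b₅)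
    (hrate : r₁ + 2 * G.κ₀ + 2 ≤ R) (h3 : 3 * A₀ * (Real.exp (b₅ + 1) * G.K₀ * G.ν * G.c₁) ≤ 1)
    (foot : D.Dom → Dk.Dom) (hmono : ∀ Z, D.dj Z ≤ Dk.dj (foot Z)) {δ κ α₆ θ : ℝ} {Gc : D.Dom → ℝ} (hα₆ : 0 < α₆)
    (hκ : Gk.κ₀ + 1 ≤ δ * κ) (h229 : Real.exp 1 * Gk.K₀ * Gk.c₁ * α₆ ≤ 1)
    (hterms : ∀ Z, terms Z ⊆ coveringFamilies Finset.univ Gk.cubes (Gk.cubes (foot Z)))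
    (hθ : 0 ≤ θ) (hGc : ∀ Z, 0 ≤ Gc Z) (hRδ : R + δ * κ ≤ (1 - 3 * δ) * κ) (hclause : θ * Real.exp (5 * R) ≤ α₆)
    (hamp : ∀ Z, G.cubes Z ⊆ G.cubes X₀ → Gc Z * (θ * α₆⁻¹ * Real.exp (5 * R)) ≤ A₀ + max 2 (A₀ / A₁) * A₁)
    (hform : ∀ Z, G.cubes Z ⊆ G.cubes X₀ → ∀ Df ∈ terms Z,
      (𝔊 k Df (emb Z)).lam.real univ * ((𝔊 k Df (emb Z)).wB * N₀ k Df (emb Z) * Real.exp (bq k Df (emb Z))) *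
          (Real.pi / (mq k Df (emb Z) / 2)) ^ (Module.finrank ℝ (α k Df) / 2 : ℝ) *
        Real.exp ((𝔊 k Df (emb Z)).N₁ * (‖h₀‖ + max 2 (A₀ / A₁) * ‖w‖)) ≤
      Gc Z * ∏ Y ∈ Df, θ * Real.exp (-((1 - 3 * δ) * κ * Dk.dj Y))) :
    ‖locE G.ι G.cubes (act 1) (G.cubes X₀) - locE G.ι G.cubes (act 0) (G.cubes X₀)‖ ≤
      4 * (Real.exp 1 * G.ν * G.c₁ * G.K₀ ^ 2) * A₁ * Real.exp (-(r₁ * D.dj X₀)) := by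
  have hE : 0 ≤ Real.exp (b₅ + 1) * G.K₀ * G.ν * G.c₁ :=
    mul_nonneg (mul_nonneg (mul_nonneg (Real.exp_nonneg _) G.K₀_nonneg) G.ν_nonneg) G.c₁_nonneg
  have hsmall : (A₀ + max 2 (A₀ / A₁) * A₁) * Real.exp (b₅ + 1) * G.K₀ * G.ν * G.c₁ ≤ 1 := by
    simpa only [mul_assoc] using pencilClause_of_printClause_three hA₁ hle hE h3
  exact attachedPart_locE_le_of_coresAt_pencil_radii D G Gk 𝔊 hroom hm hN hq hg hO hH hscale hact hA₀ hA₁.le hr₁ hb hrate hsmall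
    foot hmono hα₆ hκ h229 hterms hθ hGc hRδ hclause hamp hform (two_le_pencilRadius A₀ A₁) (intercept_le_pencilRadius_mul hA₁)

end OfGeometry

/-! ## §2 ON THE TORI OF THE PAPERS (pv22's `tgeometry 4 N` ∕ `tgeometry 4 M`): NO geometry hypothesis at either scale, clauses
LOCATED AS NUMERALS (S24–S34 §2 pattern) -/

section Torus

variable {N : ℕ} [NeZero N] {M : ℕ} [NeZero M]
variable {C : Carriers} {P : MeasPotFrame C} {Op : Type*} [NormedAddCommGroup Op] [NormedSpace ℂ Op]
  {𝒴 : ℕ → Finset (tsys 4 M).Dom → Type*} {dom : ∀ k i, 𝒴 k i → C.Dom} {β : ℕ → Finset (tsys 4 M).Dom → Type*}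
  [∀ k i, MeasurableSpace (β k i)] {α : ℕ → Finset (tsys 4 M).Dom → Type*} [∀ k i, NormedAddCommGroup (α k i)]
  [∀ k i, InnerProductSpace ℝ (α k i)] [∀ k i, FiniteDimensional ℝ (α k i)] [∀ k i, MeasurableSpace (α k i)]
  [∀ k i, BorelSpace (α k i)]

open Classical in
/-- **THE μ-PART FOR CORES INDEXED BY COVERING FAMILIES, ON THE TORI — NO GEOMETRY HYPOTHESIS AT EITHER SCALE** (kernel; N0t's
`muPart_locE_le_of_coresAt_pencil_families` ONCE at `D := tsys 4 N`, `G := tgeometry 4 N`, `Dk := tsys 4 M`, `Gk := tgeometry 4 M`, constants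
located at both scales): source pencil `h₀ + s • v` on `‖s‖ < μ₁`, class radius `hH` at `μ₁`, the located step clauses at the constant `A`,
the per-family AMPLITUDE `hAmp` at the table radius `‖h₀‖ + μ₁‖v‖` (THE place where the source window enters), `hterms`∕`foot`∕`hmono`
displayed, (2.29)'s clauses AS LOCATED NUMERALS — (B3-count) DISCHARGED inside N0t∕N0s by b13's PROVED (2.29) on `tgeometry 4 M`; for
`0 < μ₀ < μ₁`, `‖sμ‖ ≤ μ₀`: `≤ e·9·64·K₀(64,8)²·A·e^{−r₁·torusTreeLen X₀}·μ₀/(μ₁ − μ₀)`. [folklore] -/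
theorem muPart_locE_le_of_coresAt_pencil_families_torus {W : Set (ℕ → ℝ)}
    {ctr : ℕ → (ℕ → ℝ) → C.BgB → Op × B13HistM P} {ROp RHist R' : ℕ → ℝ}
    (𝔊 : ∀ k i, C.Dom → BiCore P (dom k i) Op (β k i) (α k i)) {mq bq N₀ : ℕ → Finset (tsys 4 M).Dom → C.Dom → ℝ}
    (hroom : ∀ k, ROp k < R' k)
    (hm : ∀ k, ∀ g ∈ W, ∀ (U : C.BgB) (X : C.Dom), C.scale X = k → ∀ i, 0 < mq k i X)
    (hN : ∀ k, ∀ g ∈ W, ∀ (U : C.BgB) (X : C.Dom), C.scale X = k → ∀ i,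
      (∀ o ∈ ball (ctr k g U).1 (R' k), AEStronglyMeasurable ((𝔊 k i X).N o) (𝔊 k i X).lam) ∧
      (∀ p, DifferentiableOn ℂ (fun o => (𝔊 k i X).N o p) (ball (ctr k g U).1 (R' k))) ∧
      (∀ o ∈ ball (ctr k g U).1 (R' k), ∀ p, ‖(𝔊 k i X).N o p‖ ≤ N₀ k i X))
    (hq : ∀ k, ∀ g ∈ W, ∀ (U : C.BgB) (X : C.Dom), C.scale X = k → ∀ i,
      (∀ o ∈ ball (ctr k g U).1 (R' k),
        AEStronglyMeasurable (Function.uncurry ((𝔊 k i X).q o)) ((𝔊 k i X).lam.prod volume)) ∧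
      (∀ p v, DifferentiableOn ℂ (fun o => (𝔊 k i X).q o p v) (ball (ctr k g U).1 (R' k))) ∧
      (∀ o ∈ ball (ctr k g U).1 (R' k), ∀ p v, mq k i X * ‖v‖ ^ 2 - bq k i X ≤ ((𝔊 k i X).q o p v).re))
    {k : ℕ} {g : ℕ → ℝ} (hg : g ∈ W) {U : C.BgB} {o : Op} {h₀ v : B13HistM P} {μ₁ : ℝ}
    (hO : ‖o - (ctr k g U).1‖ ≤ ROp k) (hH : ‖h₀ - (ctr k g U).2‖ + μ₁ * ‖v‖ ≤ RHist k)
    {emb : (tsys 4 N).Dom → C.Dom} (hscale : ∀ Z, C.scale (emb Z) = k)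
    {terms : (tsys 4 N).Dom → Finset (Finset (tsys 4 M).Dom)} {act : ℂ → (tsys 4 N).Dom → ℂ}
    (hact : ∀ s ∈ ball (0 : ℂ) μ₁, ∀ Z, act s Z = ∑ i ∈ terms Z, (𝔊 k i (emb Z)).termAt o (h₀ + s • v))
    {A R r₁ μ₀ : ℝ} (X₀ : (tsys 4 N).Dom) {sμ : ℂ} (hA : 0 ≤ A) (hr₁ : 0 ≤ r₁)
    (hrate : r₁ + 2 * (64 * Real.log 162) + 2 ≤ R) (hsmall : A * Real.exp (5 * r₁ + 1) * K₀ 64 8 * 9 * 64 ≤ 1)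
    (foot : (tsys 4 N).Dom → (tsys 4 M).Dom) (hmono : ∀ Z, torusTreeLen Z.1 ≤ torusTreeLen (foot Z).1) {δ κ α₆ : ℝ}
    (hα₆ : 0 ≤ α₆) (hκ : 64 * Real.log 162 + 1 ≤ δ * κ) (h229 : Real.exp 1 * K₀ 64 8 * 64 * α₆ ≤ 1)
    (hterms : ∀ Z, terms Z ⊆ coveringFamilies Finset.univ (fun Y : (tsys 4 M).Dom => Y.1) (foot Z).1)
    (hAmp : ∀ Z : (tsys 4 N).Dom, Z.1 ⊆ X₀.1 → ∀ Df ∈ terms Z,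
      (𝔊 k Df (emb Z)).lam.real univ * ((𝔊 k Df (emb Z)).wB * N₀ k Df (emb Z) * Real.exp (bq k Df (emb Z))) *
          (Real.pi / (mq k Df (emb Z) / 2)) ^ (Module.finrank ℝ (α k Df) / 2 : ℝ) *
        Real.exp ((𝔊 k Df (emb Z)).N₁ * (‖h₀‖ + μ₁ * ‖v‖)) ≤
      A * ∏ Y ∈ Df, (α₆ * Real.exp (-(δ * κ * torusTreeLen Y.1)) * Real.exp (-(R * (torusTreeLen Y.1 + 5)))))
    (h0 : 0 < μ₀) (h01 : μ₀ < μ₁) (hμ : ‖sμ‖ ≤ μ₀) :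
    ‖locE (TTouch (d := 4) (N := N)) (fun Z : (tsys 4 N).Dom => Z.1) (act sμ) X₀.1 -
        locE (TTouch (d := 4) (N := N)) (fun Z : (tsys 4 N).Dom => Z.1) (act 0) X₀.1‖ ≤
      Real.exp 1 * 9 * 64 * K₀ 64 8 ^ 2 * A * Real.exp (-(r₁ * torusTreeLen X₀.1)) * (μ₀ / (μ₁ - μ₀)) := by
  obtain ⟨hν, hκ₀, hc⟩ := torus_consts N
  obtain ⟨-, hκ₀M, hcM⟩ := torus_consts M
  have hK₀ := K₀_four (N := N)
  have hK₀M := K₀_four (N := M)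
  have h := muPart_locE_le_of_coresAt_pencil_families (tsys 4 N) (tgeometry 4 N) (tgeometry 4 M) 𝔊 hroom hm hN hq hg hO hH hscale
    hact (R := R) (b₅ := 5 * r₁) (X₀ := X₀) (sμ := sμ) hA hr₁ (le_of_eq (by ring)) (by rw [hκ₀]; exact hrate)
    (by rw [hK₀, hν, hc]; exact hsmall) foot hmono hα₆ (by rw [hκ₀M]; exact hκ) (by rw [hK₀M, hcM]; exact h229) hterms hAmp
    h0 h01 hμ
  rw [hν, hc, hK₀] at h
  exact h

open Classical in
/-- **THE RADII END ON THE TORI — NO GEOMETRY HYPOTHESIS AT EITHER SCALE** (kernel; N0t's `attachedPart_locE_le_of_coresAt_pencil_radii`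
ONCE at `D := tsys 4 N`, `G := tgeometry 4 N`, `Dk := tsys 4 M`, `Gk := tgeometry 4 M`, constants located at both scales): the (2.15)∕(2.18)-FORM
`hform` with radius letters `θ·e^{−(1−3δ)κ·torusTreeLen Y}`, the (2.28) clauses `hRδ`∕`hclause`, the amplitude bookkeeping `hamp`, general
ϱ with N0m's `hϱ`∕`hϱA`, (2.29)'s clauses AS LOCATED NUMERALS: the attached part on a torus domain `X₀` is
`≤ 4·(e·9·64·K₀(64,8)²)·A₁·e^{−r₁·torusTreeLen X₀}`. [folklore] -/
theorem attachedPart_locE_le_of_coresAt_pencil_radii_torus {W : Set (ℕ → ℝ)}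
    {ctr : ℕ → (ℕ → ℝ) → C.BgB → Op × B13HistM P} {ROp RHist R' : ℕ → ℝ}
    (𝔊 : ∀ k i, C.Dom → BiCore P (dom k i) Op (β k i) (α k i)) {mq bq N₀ : ℕ → Finset (tsys 4 M).Dom → C.Dom → ℝ}
    (hroom : ∀ k, ROp k < R' k)
    (hm : ∀ k, ∀ g ∈ W, ∀ (U : C.BgB) (X : C.Dom), C.scale X = k → ∀ i, 0 < mq k i X)
    (hN : ∀ k, ∀ g ∈ W, ∀ (U : C.BgB) (X : C.Dom), C.scale X = k → ∀ i,
      (∀ o ∈ ball (ctr k g U).1 (R' k), AEStronglyMeasurable ((𝔊 k i X).N o) (𝔊 k i X).lam) ∧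
      (∀ p, DifferentiableOn ℂ (fun o => (𝔊 k i X).N o p) (ball (ctr k g U).1 (R' k))) ∧
      (∀ o ∈ ball (ctr k g U).1 (R' k), ∀ p, ‖(𝔊 k i X).N o p‖ ≤ N₀ k i X))
    (hq : ∀ k, ∀ g ∈ W, ∀ (U : C.BgB) (X : C.Dom), C.scale X = k → ∀ i,
      (∀ o ∈ ball (ctr k g U).1 (R' k),
        AEStronglyMeasurable (Function.uncurry ((𝔊 k i X).q o)) ((𝔊 k i X).lam.prod volume)) ∧
      (∀ p v, DifferentiableOn ℂ (fun o => (𝔊 k i X).q o p v) (ball (ctr k g U).1 (R' k))) ∧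
      (∀ o ∈ ball (ctr k g U).1 (R' k), ∀ p v, mq k i X * ‖v‖ ^ 2 - bq k i X ≤ ((𝔊 k i X).q o p v).re))
    {k : ℕ} {g : ℕ → ℝ} (hg : g ∈ W) {U : C.BgB} {o : Op} {h₀ w : B13HistM P} {ϱ : ℝ}
    (hO : ‖o - (ctr k g U).1‖ ≤ ROp k) (hH : ‖h₀ - (ctr k g U).2‖ + ϱ * ‖w‖ ≤ RHist k)
    {emb : (tsys 4 N).Dom → C.Dom} (hscale : ∀ Z, C.scale (emb Z) = k)
    {terms : (tsys 4 N).Dom → Finset (Finset (tsys 4 M).Dom)} {act : ℂ → (tsys 4 N).Dom → ℂ}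
    (hact : ∀ s ∈ ball (0 : ℂ) ϱ, ∀ Z, act s Z = ∑ i ∈ terms Z, (𝔊 k i (emb Z)).termAt o (h₀ + s • w))
    {A₀ A₁ R r₁ : ℝ} (X₀ : (tsys 4 N).Dom) (hA₀ : 0 ≤ A₀) (hA₁ : 0 ≤ A₁) (hr₁ : 0 ≤ r₁)
    (hrate : r₁ + 2 * (64 * Real.log 162) + 2 ≤ R)
    (hsmall : (A₀ + ϱ * A₁) * Real.exp (5 * r₁ + 1) * K₀ 64 8 * 9 * 64 ≤ 1)
    (foot : (tsys 4 N).Dom → (tsys 4 M).Dom) (hmono : ∀ Z, torusTreeLen Z.1 ≤ torusTreeLen (foot Z).1) {δ κ α₆ θ : ℝ}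
    {Gc : (tsys 4 N).Dom → ℝ} (hα₆ : 0 < α₆) (hκ : 64 * Real.log 162 + 1 ≤ δ * κ) (h229 : Real.exp 1 * K₀ 64 8 * 64 * α₆ ≤ 1)
    (hterms : ∀ Z, terms Z ⊆ coveringFamilies Finset.univ (fun Y : (tsys 4 M).Dom => Y.1) (foot Z).1)
    (hθ : 0 ≤ θ) (hGc : ∀ Z, 0 ≤ Gc Z) (hRδ : R + δ * κ ≤ (1 - 3 * δ) * κ) (hclause : θ * Real.exp (5 * R) ≤ α₆)
    (hamp : ∀ Z : (tsys 4 N).Dom, Z.1 ⊆ X₀.1 → Gc Z * (θ * α₆⁻¹ * Real.exp (5 * R)) ≤ A₀ + ϱ * A₁)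
    (hform : ∀ Z : (tsys 4 N).Dom, Z.1 ⊆ X₀.1 → ∀ Df ∈ terms Z,
      (𝔊 k Df (emb Z)).lam.real univ * ((𝔊 k Df (emb Z)).wB * N₀ k Df (emb Z) * Real.exp (bq k Df (emb Z))) *
          (Real.pi / (mq k Df (emb Z) / 2)) ^ (Module.finrank ℝ (α k Df) / 2 : ℝ) *
        Real.exp ((𝔊 k Df (emb Z)).N₁ * (‖h₀‖ + ϱ * ‖w‖)) ≤
      Gc Z * ∏ Y ∈ Df, θ * Real.exp (-((1 - 3 * δ) * κ * torusTreeLen Y.1)))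
    (hϱ : 2 ≤ ϱ) (hϱA : A₀ ≤ ϱ * A₁) :
    ‖locE (TTouch (d := 4) (N := N)) (fun Z : (tsys 4 N).Dom => Z.1) (act 1) X₀.1 -
        locE (TTouch (d := 4) (N := N)) (fun Z : (tsys 4 N).Dom => Z.1) (act 0) X₀.1‖ ≤
      4 * (Real.exp 1 * 9 * 64 * K₀ 64 8 ^ 2) * A₁ * Real.exp (-(r₁ * torusTreeLen X₀.1)) := by
  obtain ⟨hν, hκ₀, hc⟩ := torus_consts N
  obtain ⟨-, hκ₀M, hcM⟩ := torus_consts M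
  have hK₀ := K₀_four (N := N)
  have hK₀M := K₀_four (N := M)
  have h := attachedPart_locE_le_of_coresAt_pencil_radii (tsys 4 N) (tgeometry 4 N) (tgeometry 4 M) 𝔊 hroom hm hN hq hg hO hH hscale
    hact (R := R) (b₅ := 5 * r₁) (X₀ := X₀) hA₀ hA₁ hr₁ (le_of_eq (by ring)) (by rw [hκ₀]; exact hrate)
    (by rw [hK₀, hν, hc]; exact hsmall) foot hmono hα₆ (by rw [hκ₀M]; exact hκ) (by rw [hK₀M, hcM]; exact h229) hterms hθ hGc
    hRδ hclause hamp hform hϱ hϱA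
  rw [hν, hc, hK₀] at h
  exact h

open Classical in
/-- **THE RADII END ON THE TORI, ϱ-FREE — NO GEOMETRY HYPOTHESIS, NO RADIUS BINDER** (kernel; §1's
`attachedPart_locE_le_of_coresAt_pencil_radii_printClause_three` at `tgeometry 4 N` ∕ `tgeometry 4 M`, constants located): live slope
`0 < A₁ ≤ A₀`, «κ large» `r₁ + 2·(64·log 162) + 2 ≤ R` and `64·log 162 + 1 ≤ δκ`, «ε₁ small with the sharp factor-3 room»
`3·A₀·(e^{5r₁+1}·K₀(64,8)·9·64) ≤ 1`, «α₆ small» `e·K₀(64,8)·64·α₆ ≤ 1`, the (2.28) clauses, `hH` ∕ `hform` ∕ `hamp` READ AT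
`ϱ⋆ = max 2 (A₀/A₁)` ⇒ the same located bound. [folklore] -/
theorem attachedPart_locE_le_of_coresAt_pencil_radii_printClause_three_torus {W : Set (ℕ → ℝ)}
    {ctr : ℕ → (ℕ → ℝ) → C.BgB → Op × B13HistM P} {ROp RHist R' : ℕ → ℝ}
    (𝔊 : ∀ k i, C.Dom → BiCore P (dom k i) Op (β k i) (α k i)) {mq bq N₀ : ℕ → Finset (tsys 4 M).Dom → C.Dom → ℝ}
    (hroom : ∀ k, ROp k < R' k)
    (hm : ∀ k, ∀ g ∈ W, ∀ (U : C.BgB) (X : C.Dom), C.scale X = k → ∀ i, 0 < mq k i X)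
    (hN : ∀ k, ∀ g ∈ W, ∀ (U : C.BgB) (X : C.Dom), C.scale X = k → ∀ i,
      (∀ o ∈ ball (ctr k g U).1 (R' k), AEStronglyMeasurable ((𝔊 k i X).N o) (𝔊 k i X).lam) ∧
      (∀ p, DifferentiableOn ℂ (fun o => (𝔊 k i X).N o p) (ball (ctr k g U).1 (R' k))) ∧
      (∀ o ∈ ball (ctr k g U).1 (R' k), ∀ p, ‖(𝔊 k i X).N o p‖ ≤ N₀ k i X))
    (hq : ∀ k, ∀ g ∈ W, ∀ (U : C.BgB) (X : C.Dom), C.scale X = k → ∀ i,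
      (∀ o ∈ ball (ctr k g U).1 (R' k),
        AEStronglyMeasurable (Function.uncurry ((𝔊 k i X).q o)) ((𝔊 k i X).lam.prod volume)) ∧
      (∀ p v, DifferentiableOn ℂ (fun o => (𝔊 k i X).q o p v) (ball (ctr k g U).1 (R' k))) ∧
      (∀ o ∈ ball (ctr k g U).1 (R' k), ∀ p v, mq k i X * ‖v‖ ^ 2 - bq k i X ≤ ((𝔊 k i X).q o p v).re))
    {k : ℕ} {g : ℕ → ℝ} (hg : g ∈ W) {U : C.BgB} {o : Op} {h₀ w : B13HistM P} {A₀ A₁ : ℝ}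
    (hO : ‖o - (ctr k g U).1‖ ≤ ROp k) (hH : ‖h₀ - (ctr k g U).2‖ + max 2 (A₀ / A₁) * ‖w‖ ≤ RHist k)
    {emb : (tsys 4 N).Dom → C.Dom} (hscale : ∀ Z, C.scale (emb Z) = k)
    {terms : (tsys 4 N).Dom → Finset (Finset (tsys 4 M).Dom)} {act : ℂ → (tsys 4 N).Dom → ℂ}
    (hact : ∀ s ∈ ball (0 : ℂ) (max 2 (A₀ / A₁)), ∀ Z, act s Z = ∑ i ∈ terms Z, (𝔊 k i (emb Z)).termAt o (h₀ + s • w))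
    {R r₁ : ℝ} (X₀ : (tsys 4 N).Dom) (hA₀ : 0 ≤ A₀) (hA₁ : 0 < A₁) (hle : A₁ ≤ A₀) (hr₁ : 0 ≤ r₁)
    (hrate : r₁ + 2 * (64 * Real.log 162) + 2 ≤ R) (h3 : 3 * A₀ * (Real.exp (5 * r₁ + 1) * K₀ 64 8 * 9 * 64) ≤ 1)
    (foot : (tsys 4 N).Dom → (tsys 4 M).Dom) (hmono : ∀ Z, torusTreeLen Z.1 ≤ torusTreeLen (foot Z).1) {δ κ α₆ θ : ℝ}
    {Gc : (tsys 4 N).Dom → ℝ} (hα₆ : 0 < α₆) (hκ : 64 * Real.log 162 + 1 ≤ δ * κ) (h229 : Real.exp 1 * K₀ 64 8 * 64 * α₆ ≤ 1)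
    (hterms : ∀ Z, terms Z ⊆ coveringFamilies Finset.univ (fun Y : (tsys 4 M).Dom => Y.1) (foot Z).1)
    (hθ : 0 ≤ θ) (hGc : ∀ Z, 0 ≤ Gc Z) (hRδ : R + δ * κ ≤ (1 - 3 * δ) * κ) (hclause : θ * Real.exp (5 * R) ≤ α₆)
    (hamp : ∀ Z : (tsys 4 N).Dom, Z.1 ⊆ X₀.1 → Gc Z * (θ * α₆⁻¹ * Real.exp (5 * R)) ≤ A₀ + max 2 (A₀ / A₁) * A₁)
    (hform : ∀ Z : (tsys 4 N).Dom, Z.1 ⊆ X₀.1 → ∀ Df ∈ terms Z,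
      (𝔊 k Df (emb Z)).lam.real univ * ((𝔊 k Df (emb Z)).wB * N₀ k Df (emb Z) * Real.exp (bq k Df (emb Z))) *
          (Real.pi / (mq k Df (emb Z) / 2)) ^ (Module.finrank ℝ (α k Df) / 2 : ℝ) *
        Real.exp ((𝔊 k Df (emb Z)).N₁ * (‖h₀‖ + max 2 (A₀ / A₁) * ‖w‖)) ≤
      Gc Z * ∏ Y ∈ Df, θ * Real.exp (-((1 - 3 * δ) * κ * torusTreeLen Y.1))) :
    ‖locE (TTouch (d := 4) (N := N)) (fun Z : (tsys 4 N).Dom => Z.1) (act 1) X₀.1 -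
        locE (TTouch (d := 4) (N := N)) (fun Z : (tsys 4 N).Dom => Z.1) (act 0) X₀.1‖ ≤
      4 * (Real.exp 1 * 9 * 64 * K₀ 64 8 ^ 2) * A₁ * Real.exp (-(r₁ * torusTreeLen X₀.1)) := by
  obtain ⟨hν, hκ₀, hc⟩ := torus_consts N
  obtain ⟨-, hκ₀M, hcM⟩ := torus_consts M
  have hK₀ := K₀_four (N := N)
  have hK₀M := K₀_four (N := M)
  have h := attachedPart_locE_le_of_coresAt_pencil_radii_printClause_three (tsys 4 N) (tgeometry 4 N) (tgeometry 4 M) 𝔊 hroom hm hN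
    hq hg hO hH hscale hact (R := R) (b₅ := 5 * r₁) (X₀ := X₀) hA₀ hA₁ hle hr₁ (le_of_eq (by ring)) (by rw [hκ₀]; exact hrate)
    (by rw [hK₀, hν, hc]; exact h3) foot hmono hα₆ (by rw [hκ₀M]; exact hκ) (by rw [hK₀M, hcM]; exact h229) hterms hθ hGc hRδ
    hclause hamp hform
  rw [hν, hc, hK₀] at h
  exact h

/-! ## §3 Consistency — the (2.28) ∘ torus square commutes, in kernel -/

open Classical in
/-- (E) THE COMMUTING SQUARE: §2's `attachedPart_locE_le_of_coresAt_pencil_radii_torus` IS S34 PART 2's located families END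
`DressedSmallFieldCoveringFamiliesFaces.attachedPart_locE_le_of_coresAt_pencil_families_torus` with the per-family AMPLITUDE `hAmp` SUPPLIED
from the (2.15)∕(2.18)-FORM `hform` by N0t's (2.28) arithmetic `prod_radiusLetters_le` (families nonempty by `nonempty_of_mem_coveringFamilies`
at the torus footprint `(foot Z).2.1`) and the bookkeeping `hamp` — N0t's own proof transplanted to the tori (radii-then-torus =
torus-then-radii).  This file asserts NO new inequality. [folklore] -/
example {W : Set (ℕ → ℝ)}
    {ctr : ℕ → (ℕ → ℝ) → C.BgB → Op × B13HistM P} {ROp RHist R' : ℕ → ℝ}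
    (𝔊 : ∀ k i, C.Dom → BiCore P (dom k i) Op (β k i) (α k i)) {mq bq N₀ : ℕ → Finset (tsys 4 M).Dom → C.Dom → ℝ}
    (hroom : ∀ k, ROp k < R' k)
    (hm : ∀ k, ∀ g ∈ W, ∀ (U : C.BgB) (X : C.Dom), C.scale X = k → ∀ i, 0 < mq k i X)
    (hN : ∀ k, ∀ g ∈ W, ∀ (U : C.BgB) (X : C.Dom), C.scale X = k → ∀ i,
      (∀ o ∈ ball (ctr k g U).1 (R' k), AEStronglyMeasurable ((𝔊 k i X).N o) (𝔊 k i X).lam) ∧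
      (∀ p, DifferentiableOn ℂ (fun o => (𝔊 k i X).N o p) (ball (ctr k g U).1 (R' k))) ∧
      (∀ o ∈ ball (ctr k g U).1 (R' k), ∀ p, ‖(𝔊 k i X).N o p‖ ≤ N₀ k i X))
    (hq : ∀ k, ∀ g ∈ W, ∀ (U : C.BgB) (X : C.Dom), C.scale X = k → ∀ i,
      (∀ o ∈ ball (ctr k g U).1 (R' k),
        AEStronglyMeasurable (Function.uncurry ((𝔊 k i X).q o)) ((𝔊 k i X).lam.prod volume)) ∧
      (∀ p v, DifferentiableOn ℂ (fun o => (𝔊 k i X).q o p v) (ball (ctr k g U).1 (R' k))) ∧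
      (∀ o ∈ ball (ctr k g U).1 (R' k), ∀ p v, mq k i X * ‖v‖ ^ 2 - bq k i X ≤ ((𝔊 k i X).q o p v).re))
    {k : ℕ} {g : ℕ → ℝ} (hg : g ∈ W) {U : C.BgB} {o : Op} {h₀ w : B13HistM P} {ϱ : ℝ}
    (hO : ‖o - (ctr k g U).1‖ ≤ ROp k) (hH : ‖h₀ - (ctr k g U).2‖ + ϱ * ‖w‖ ≤ RHist k)
    {emb : (tsys 4 N).Dom → C.Dom} (hscale : ∀ Z, C.scale (emb Z) = k)
    {terms : (tsys 4 N).Dom → Finset (Finset (tsys 4 M).Dom)} {act : ℂ → (tsys 4 N).Dom → ℂ}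
    (hact : ∀ s ∈ ball (0 : ℂ) ϱ, ∀ Z, act s Z = ∑ i ∈ terms Z, (𝔊 k i (emb Z)).termAt o (h₀ + s • w))
    {A₀ A₁ R r₁ : ℝ} (X₀ : (tsys 4 N).Dom) (hA₀ : 0 ≤ A₀) (hA₁ : 0 ≤ A₁) (hr₁ : 0 ≤ r₁)
    (hrate : r₁ + 2 * (64 * Real.log 162) + 2 ≤ R)
    (hsmall : (A₀ + ϱ * A₁) * Real.exp (5 * r₁ + 1) * K₀ 64 8 * 9 * 64 ≤ 1)
    (foot : (tsys 4 N).Dom → (tsys 4 M).Dom) (hmono : ∀ Z, torusTreeLen Z.1 ≤ torusTreeLen (foot Z).1) {δ κ α₆ θ : ℝ}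
    {Gc : (tsys 4 N).Dom → ℝ} (hα₆ : 0 < α₆) (hκ : 64 * Real.log 162 + 1 ≤ δ * κ) (h229 : Real.exp 1 * K₀ 64 8 * 64 * α₆ ≤ 1)
    (hterms : ∀ Z, terms Z ⊆ coveringFamilies Finset.univ (fun Y : (tsys 4 M).Dom => Y.1) (foot Z).1)
    (hθ : 0 ≤ θ) (hGc : ∀ Z, 0 ≤ Gc Z) (hRδ : R + δ * κ ≤ (1 - 3 * δ) * κ) (hclause : θ * Real.exp (5 * R) ≤ α₆)
    (hamp : ∀ Z : (tsys 4 N).Dom, Z.1 ⊆ X₀.1 → Gc Z * (θ * α₆⁻¹ * Real.exp (5 * R)) ≤ A₀ + ϱ * A₁)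
    (hform : ∀ Z : (tsys 4 N).Dom, Z.1 ⊆ X₀.1 → ∀ Df ∈ terms Z,
      (𝔊 k Df (emb Z)).lam.real univ * ((𝔊 k Df (emb Z)).wB * N₀ k Df (emb Z) * Real.exp (bq k Df (emb Z))) *
          (Real.pi / (mq k Df (emb Z) / 2)) ^ (Module.finrank ℝ (α k Df) / 2 : ℝ) *
        Real.exp ((𝔊 k Df (emb Z)).N₁ * (‖h₀‖ + ϱ * ‖w‖)) ≤
      Gc Z * ∏ Y ∈ Df, θ * Real.exp (-((1 - 3 * δ) * κ * torusTreeLen Y.1)))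
    (hϱ : 2 ≤ ϱ) (hϱA : A₀ ≤ ϱ * A₁) :
    ‖locE (TTouch (d := 4) (N := N)) (fun Z : (tsys 4 N).Dom => Z.1) (act 1) X₀.1 -
        locE (TTouch (d := 4) (N := N)) (fun Z : (tsys 4 N).Dom => Z.1) (act 0) X₀.1‖ ≤
      4 * (Real.exp 1 * 9 * 64 * K₀ 64 8 ^ 2) * A₁ * Real.exp (-(r₁ * torusTreeLen X₀.1)) := by
  refine attachedPart_locE_le_of_coresAt_pencil_families_torus 𝔊 hroom hm hN hq hg hO hH hscale hact X₀ hA₀ hA₁ hr₁ hrate hsmall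
    foot hmono hα₆.le hκ h229 hterms (fun Z hZ Df hDf => (hform Z hZ Df hDf).trans ?_) hϱ hϱA
  have hne : Df.Nonempty :=
    nonempty_of_mem_coveringFamilies (cubesK := fun Y : (tsys 4 M).Dom => Y.1) (foot Z).2.1 (hterms Z hDf)
  have h228 := prod_radiusLetters_le Df hne (fun Y : (tsys 4 M).Dom => torusTreeLen Y.1) hθ hα₆
    (fun Y _ => torusTreeLen_nonneg Y.1) hRδ hclause
  calc Gc Z * ∏ Y ∈ Df, θ * Real.exp (-((1 - 3 * δ) * κ * torusTreeLen Y.1))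
      ≤ Gc Z * ((θ * α₆⁻¹ * Real.exp (5 * R)) *
          ∏ Y ∈ Df, (α₆ * Real.exp (-(δ * κ * torusTreeLen Y.1)) * Real.exp (-(R * (torusTreeLen Y.1 + 5))))) :=
        mul_le_mul_of_nonneg_left h228 (hGc Z)
    _ = Gc Z * (θ * α₆⁻¹ * Real.exp (5 * R)) *
          ∏ Y ∈ Df, (α₆ * Real.exp (-(δ * κ * torusTreeLen Y.1)) * Real.exp (-(R * (torusTreeLen Y.1 + 5)))) := by ring
    _ ≤ (A₀ + ϱ * A₁) * ∏ Y ∈ Df, (α₆ * Real.exp (-(δ * κ * torusTreeLen Y.1)) * Real.exp (-(R * (torusTreeLen Y.1 + 5)))) :=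
        mul_le_mul_of_nonneg_right (hamp Z hZ) (Finset.prod_nonneg fun Y _ => by positivity)

end Torus

end Summit.QuantumFields.BalabanUV.T4Continuum.NE1p.DressedSmallFieldFamilyAmplitudeFaces

end
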